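import Literature.NumberTheory.LFunctions.ZetaScrewThm17Proofs
import HarnessLib

/-!
# Mellin plumbing for the doubling defect of Suzuki's `Ψ` (crux `ScrewSquaringLaw.DyadicLandau`,
stmt-RiemannHypothesis-23894, `--supports`)

Route `ScrewSquaringLaw` (L45), line «DoublingChain».  `Ψ = zetaScrew` (Suzuki 2023, arXiv:2206.03682,
(1.1)); `R(s) = s⁻² (ξ'/ξ)(½ + s)` is the Laplace transform of `Ψ` on `Re s > ½` (Thm 1.1 (1), tree
`ZetaScrewLaplace.integral_zetaScrew_mul_cexp`, `ZetaScrewLandau.mellinIoi_eq_of_re_gt`).  In the Mellin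
variable `x = e^t` of the tree's Landau lemma (`Landau.mellinIoi g s = ∫_1^∞ g(x) x^{-(s+1)} dx`):

* `mellinIoi_comp_log`, `integrableOn_doublingDefect_iff` — the substitution `x = e^t`;
* `integral_zetaScrew_two_mul_cexp` — `∫_0^∞ Ψ(2t) e^{-st} dt = ½ R(s/2)` for `Re s > 1` (`u = 2t`);
  `integrableOn_zetaScrew_two_mul_log_rpow`, `mellinIoi_zetaScrew_two_mul_log` — the same for
  `x ↦ Ψ(2 log x)`;
* `mellinIoi_const` — `∫_1^∞ K x^{-(s+1)} dx = K/s` for `Re s > 0`;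
* `measurable_doublingDefectLog`, `integrableOn_doublingDefectLog_two`, `mellinIoi_doublingDefectLog` —
  the doubling defect `g(x) = 4Ψ(log x) − Ψ(2 log x) + K` is measurable, its Mellin integrand converges
  absolutely at `σ = 2`, and on `Re s > 2` its transform is `Φ(s) = 4R(s) − ½R(s/2) + K/s`.

All statements are unconditional real/complex analysis about `ζ`'s own screw function; RH is not
proved here and nothing here bears on the truth of RH.
-/

-- `Summit.RiemannHypothesis.RiemannHypothesis.…` repeats a component by the tree's layout (D-0017).
set_option linter.dupNamespace false

noncomputable section

open Complex Filter Topology Set MeasureTheory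

namespace Summit.RiemannHypothesis.RiemannHypothesis.Theorems.ScrewSquaringLaw

open Literature.NumberTheory.LFunctions Literature.NumberTheory.LFunctions.ZetaScrewLandau

/-! ## The substitution `x = e^t` for `D ∘ log` -/

/-- `∫_1^∞ D(log x) x^{-(s+1)} dx = ∫_0^∞ D(t) e^{-st} dt` (Bochner integrals; `x = e^t`). -/
theorem mellinIoi_comp_log (D : ℝ → ℝ) (s : ℂ) :
    Landau.mellinIoi (fun x ↦ D (Real.log x)) s =
      ∫ t in Ioi (0 : ℝ), (D t : ℂ) * cexp (-s * t) := by
  unfold Landau.mellinIoi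
  rw [integral_Ioi_one_eq_integral_Ioi_zero]
  refine setIntegral_congr_fun measurableSet_Ioi fun t _ ↦ ?_
  dsimp only
  rw [Real.log_exp, ofReal_exp_cpow, Complex.real_smul, Complex.ofReal_exp]
  have : cexp (t : ℂ) * cexp ((t : ℂ) * -(s + 1)) = cexp (-s * t) := by
    rw [← Complex.exp_add]
    congr 1
    ring
  rw [← this]
  ring

/-- The doubling defect in the two variables: `(4Ψ(log x) − Ψ(2 log x) + K) x^{-(σ+1)} ∈ L¹(1,∞)`
iff `(4Ψ(t) − Ψ(2t) + K) e^{-σt} ∈ L¹(0,∞)` (`x = e^t`; the tree's `integrableOn_zetaScrew_log_iff` /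
`ScrewExcursionDoorExcursionDoor.integrableOn_log_rpow_iff` pattern, stated for this defect). -/
theorem integrableOn_doublingDefect_iff (K σ : ℝ) :
    IntegrableOn (fun x : ℝ ↦ (4 * zetaScrew (Real.log x) - zetaScrew (2 * Real.log x) + K) *
        x ^ (-(σ + 1))) (Ioi 1) ↔
      IntegrableOn (fun t : ℝ ↦ (4 * zetaScrew t - zetaScrew (2 * t) + K) * Real.exp (-σ * t))
        (Ioi 0) := by
  rw [integrableOn_Ioi_one_iff]
  refine integrableOn_congr_fun (fun t _ ↦ ?_) measurableSet_Ioi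
  rw [smul_eq_mul, Real.log_exp, Real.rpow_def_of_pos (Real.exp_pos t), Real.log_exp]
  have : Real.exp t * Real.exp (t * -(σ + 1)) = Real.exp (-σ * t) := by
    rw [← Real.exp_add]
    congr 1
    ring
  rw [← this]
  ring

/-- Real Laplace integrability `D(t) e^{-σt} ∈ L¹(0,∞)` from complex Laplace integrability
`(D t : ℂ) e^{-st} ∈ L¹(0,∞)` with `Re s = σ`, for measurable `D`. -/
theorem integrableOn_mul_exp_of_cexp {D : ℝ → ℝ} (hD : Measurable D) {s : ℂ}
    (h : IntegrableOn (fun t : ℝ ↦ (D t : ℂ) * cexp (-s * t)) (Ioi 0)) :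
    IntegrableOn (fun t : ℝ ↦ D t * Real.exp (-s.re * t)) (Ioi 0) := by
  have hmeas : AEStronglyMeasurable (fun t : ℝ ↦ D t * Real.exp (-s.re * t))
      (volume.restrict (Ioi 0)) :=
    (hD.mul (Real.continuous_exp.comp (continuous_const.mul continuous_id)).measurable).aestronglyMeasurable
  have hn : IntegrableOn (fun t : ℝ ↦ ‖(D t : ℂ) * cexp (-s * t)‖) (Ioi 0) := h.norm
  refine (integrable_norm_iff hmeas).1 (hn.congr_fun (fun t _ ↦ ?_) measurableSet_Ioi)
  dsimp only
  rw [norm_mul, norm_mul, Complex.norm_real, Real.norm_eq_abs,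
    ZetaScrewLaplace.norm_cexp_mul_ofReal, Real.norm_of_nonneg (Real.exp_pos _).le]
  simp

/-! ## `Ψ(2t)`: the transform is `½ R(s/2)` on `Re s > 1` -/

/-- **`∫_0^∞ Ψ(2t) e^{-st} dt = ½ · (s/2)⁻² (ξ'/ξ)(½ + s/2)`** for `Re s > 1`, the integral converging
absolutely (substitute `u = 2t` in Suzuki2023 Thm 1.1 (1) at `s/2`, `Re (s/2) > ½`). -/
theorem integral_zetaScrew_two_mul_cexp {s : ℂ} (hs : 1 < s.re) :
    IntegrableOn (fun t : ℝ ↦ (zetaScrew (2 * t) : ℂ) * cexp (-s * t)) (Ioi 0) ∧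
      ∫ t in Ioi (0 : ℝ), (zetaScrew (2 * t) : ℂ) * cexp (-s * t) =
        1 / 2 * (1 / (s / 2) ^ 2 * logDeriv riemannXi (1 / 2 + s / 2)) := by
  have ha : (-(s / 2)).re < -1 / 2 := by
    rw [neg_re, Complex.div_ofNat_re]
    linarith
  obtain ⟨hint, hval⟩ := ZetaScrewLaplace.integral_zetaScrew_mul_cexp ha
  have hG2 : (fun t : ℝ ↦ (zetaScrew (2 * t) : ℂ) * cexp (-s * t)) =
      fun t ↦ (fun u : ℝ ↦ (zetaScrew u : ℂ) * cexp (-(s / 2) * u)) (2 * t) := by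
    funext t
    have e : cexp (-s * (t : ℂ)) = cexp (-(s / 2) * ((2 * t : ℝ) : ℂ)) := by
      congr 1
      push_cast
      ring
    simp only [e]
  refine ⟨?_, ?_⟩
  · rw [hG2, integrableOn_Ioi_comp_mul_left_iff (fun u : ℝ ↦ (zetaScrew u : ℂ) * cexp (-(s / 2) * u))
      0 two_pos, mul_zero]
    exact hint
  · rw [hG2, integral_comp_mul_left_Ioi (fun u : ℝ ↦ (zetaScrew u : ℂ) * cexp (-(s / 2) * u))
      0 two_pos, mul_zero, hval, Complex.real_smul, sub_neg_eq_add, neg_sq]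
    push_cast
    ring

/-- For real `σ > 1`, `Ψ(2 log x) x^{-(σ+1)} ∈ L¹(1, ∞)`. -/
theorem integrableOn_zetaScrew_two_mul_log_rpow {σ : ℝ} (hσ : 1 < σ) :
    IntegrableOn (fun x : ℝ ↦ zetaScrew (2 * Real.log x) * x ^ (-(σ + 1))) (Ioi 1) := by
  -- `x = e^t`: reduce to `Ψ(2t) e^{-σt} ∈ L¹(0, ∞)`
  have hiff : IntegrableOn (fun x : ℝ ↦ zetaScrew (2 * Real.log x) * x ^ (-(σ + 1))) (Ioi 1) ↔
      IntegrableOn (fun t : ℝ ↦ zetaScrew (2 * t) * Real.exp (-σ * t)) (Ioi 0) := by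
    rw [integrableOn_Ioi_one_iff]
    refine integrableOn_congr_fun (fun t _ ↦ ?_) measurableSet_Ioi
    rw [smul_eq_mul, Real.log_exp, Real.rpow_def_of_pos (Real.exp_pos t), Real.log_exp]
    have : Real.exp t * Real.exp (t * -(σ + 1)) = Real.exp (-σ * t) := by
      rw [← Real.exp_add]
      congr 1
      ring
    rw [← this]
    ring
  rw [hiff]
  have h := (integral_zetaScrew_two_mul_cexp (s := (σ : ℂ)) (by simpa using hσ)).1
  have hD : Measurable (fun t : ℝ ↦ zetaScrew (2 * t)) :=
    continuous_zetaScrew.measurable.comp (measurable_const.mul measurable_id)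
  simpa using integrableOn_mul_exp_of_cexp hD h

/-- **`∫_1^∞ Ψ(2 log x) x^{-(s+1)} dx = ½ (s/2)⁻² (ξ'/ξ)(½ + s/2)`** (`= ½ R(s/2)`) for `Re s > 1`. -/
theorem mellinIoi_zetaScrew_two_mul_log {s : ℂ} (hs : 1 < s.re) :
    Landau.mellinIoi (fun x ↦ zetaScrew (2 * Real.log x)) s =
      1 / 2 * (1 / (s / 2) ^ 2 * logDeriv riemannXi (1 / 2 + s / 2)) := by
  rw [mellinIoi_comp_log (fun t ↦ zetaScrew (2 * t)) s]
  exact (integral_zetaScrew_two_mul_cexp hs).2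

/-! ## Constants: `∫_1^∞ K x^{-(s+1)} dx = K/s` -/

/-- `∫_1^∞ K x^{-(s+1)} dx = K / s` for `Re s > 0`. -/
theorem mellinIoi_const (K : ℝ) {s : ℂ} (hs : 0 < s.re) :
    Landau.mellinIoi (fun _ ↦ K) s = K / s := by
  unfold Landau.mellinIoi
  have ha : (-(s + 1)).re < -1 := by simp; linarith
  rw [integral_const_mul, integral_Ioi_cpow_of_lt ha zero_lt_one]
  have hs0 : s ≠ 0 := fun h ↦ by rw [h, zero_re] at hs; exact lt_irrefl _ hs
  have h1 : -(s + 1) + 1 = -s := by ring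
  rw [h1, Complex.ofReal_one, Complex.one_cpow]
  field_simp

/-! ## The doubling defect `g(x) = 4Ψ(log x) − Ψ(2 log x) + K` -/

/-- Measurability of `x ↦ 4Ψ(log x) − Ψ(2 log x) + K`. -/
theorem measurable_doublingDefectLog (K : ℝ) :
    Measurable (fun x : ℝ ↦ 4 * zetaScrew (Real.log x) - zetaScrew (2 * Real.log x) + K) := by
  have h1 : Measurable (fun x : ℝ ↦ zetaScrew (Real.log x)) :=
    continuous_zetaScrew.measurable.comp Real.measurable_log
  have h2 : Measurable (fun x : ℝ ↦ zetaScrew (2 * Real.log x)) :=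
    continuous_zetaScrew.measurable.comp (measurable_const.mul Real.measurable_log)
  exact ((measurable_const.mul h1).sub h2).add_const K

/-- Absolute convergence of the Mellin integrand of the doubling defect at `σ = 2`:
`(4Ψ(log x) − Ψ(2 log x) + K) x^{-3} ∈ L¹(1, ∞)`. -/
theorem integrableOn_doublingDefectLog_two (K : ℝ) :
    IntegrableOn (fun x : ℝ ↦ (4 * zetaScrew (Real.log x) - zetaScrew (2 * Real.log x) + K) *
      x ^ (-((2 : ℝ) + 1))) (Ioi 1) := by
  have h1 := integrableOn_zetaScrew_log_rpow (σ := 2) (by norm_num)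
  have h2 := integrableOn_zetaScrew_two_mul_log_rpow (σ := 2) (by norm_num)
  have h3 : IntegrableOn (fun x : ℝ ↦ K * x ^ (-((2 : ℝ) + 1))) (Ioi 1) :=
    (integrableOn_Ioi_rpow_of_lt (by norm_num) zero_lt_one).const_mul K
  have h1' : IntegrableOn (fun x : ℝ ↦ 4 * (zetaScrew (Real.log x) * x ^ (-((2 : ℝ) + 1)))) (Ioi 1) :=
    h1.const_mul 4
  refine ((h1'.sub h2).add h3).congr_fun (fun x _ ↦ ?_) measurableSet_Ioi
  simp only [Pi.add_apply, Pi.sub_apply]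
  ring

/-- **The transform of the doubling defect** on `Re s > 2`:
`∫_1^∞ (4Ψ(log x) − Ψ(2 log x) + K) x^{-(s+1)} dx = 4 R(s) − ½ R(s/2) + K/s`,
`R(s) = s⁻² (ξ'/ξ)(½+s)`. -/
theorem mellinIoi_doublingDefectLog (K : ℝ) {s : ℂ} (hs : 2 < s.re) :
    Landau.mellinIoi (fun x : ℝ ↦ 4 * zetaScrew (Real.log x) - zetaScrew (2 * Real.log x) + K) s =
      4 * (1 / s ^ 2 * logDeriv riemannXi (1 / 2 + s)) -
        1 / 2 * (1 / (s / 2) ^ 2 * logDeriv riemannXi (1 / 2 + s / 2)) + K / s := by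
  have hg₁ : Measurable (fun x : ℝ ↦ zetaScrew (Real.log x)) :=
    continuous_zetaScrew.measurable.comp Real.measurable_log
  have hg₂ : Measurable (fun x : ℝ ↦ zetaScrew (2 * Real.log x)) :=
    continuous_zetaScrew.measurable.comp (measurable_const.mul Real.measurable_log)
  have hI₁ : Integrable (fun x : ℝ ↦ ((zetaScrew (Real.log x) : ℝ) : ℂ) * (x : ℂ) ^ (-(s + 1)))
      (volume.restrict (Ioi 1)) := by
    have h := Landau.integrable_mellinIntegrand hg₁
      (integrableOn_zetaScrew_log_rpow (σ := 1) (by norm_num)) 0 (s := s) (by linarith)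
    refine h.congr (Eventually.of_forall fun x ↦ ?_)
    simp [Landau.mellinIntegrand]
  have hI₂ : Integrable (fun x : ℝ ↦ ((zetaScrew (2 * Real.log x) : ℝ) : ℂ) * (x : ℂ) ^ (-(s + 1)))
      (volume.restrict (Ioi 1)) := by
    have h := Landau.integrable_mellinIntegrand hg₂
      (integrableOn_zetaScrew_two_mul_log_rpow (σ := 3 / 2) (by norm_num)) 0 (s := s) (by linarith)
    refine h.congr (Eventually.of_forall fun x ↦ ?_)
    simp [Landau.mellinIntegrand]
  have hI₃ : Integrable (fun x : ℝ ↦ ((K : ℝ) : ℂ) * (x : ℂ) ^ (-(s + 1)))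
      (volume.restrict (Ioi 1)) := by
    have h := Landau.integrable_mellinIntegrand (g := fun _ : ℝ ↦ K) measurable_const
      (σ₁ := 1) ((integrableOn_Ioi_rpow_of_lt (by norm_num) zero_lt_one).const_mul K) 0 (s := s)
      (by linarith)
    refine h.congr (Eventually.of_forall fun x ↦ ?_)
    simp [Landau.mellinIntegrand]
  have hR₁ : Landau.mellinIoi (fun x : ℝ ↦ zetaScrew (Real.log x)) s =
      1 / s ^ 2 * logDeriv riemannXi (1 / 2 + s) := mellinIoi_eq_of_re_gt (by linarith)
  have hR₂ := mellinIoi_zetaScrew_two_mul_log (s := s) (by linarith)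
  have hR₃ := mellinIoi_const K (s := s) (by linarith)
  calc Landau.mellinIoi (fun x : ℝ ↦ 4 * zetaScrew (Real.log x) - zetaScrew (2 * Real.log x) + K) s
      = ∫ x in Ioi (1 : ℝ), ((4 * (((zetaScrew (Real.log x) : ℝ) : ℂ) * (x : ℂ) ^ (-(s + 1)))
          - ((zetaScrew (2 * Real.log x) : ℝ) : ℂ) * (x : ℂ) ^ (-(s + 1)))
          + ((K : ℝ) : ℂ) * (x : ℂ) ^ (-(s + 1))) := by
        unfold Landau.mellinIoi
        refine setIntegral_congr_fun measurableSet_Ioi fun x _ ↦ ?_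
        push_cast
        ring
    _ = 4 * Landau.mellinIoi (fun x : ℝ ↦ zetaScrew (Real.log x)) s
          - Landau.mellinIoi (fun x : ℝ ↦ zetaScrew (2 * Real.log x)) s
          + Landau.mellinIoi (fun _ : ℝ ↦ K) s := by
        have h4 : Integrable (fun x : ℝ ↦ (4 : ℂ) * (((zetaScrew (Real.log x) : ℝ) : ℂ) *
            (x : ℂ) ^ (-(s + 1)))) (volume.restrict (Ioi 1)) := hI₁.const_mul 4
        have h12 : Integrable (fun x : ℝ ↦ (4 : ℂ) * (((zetaScrew (Real.log x) : ℝ) : ℂ) *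
            (x : ℂ) ^ (-(s + 1))) - ((zetaScrew (2 * Real.log x) : ℝ) : ℂ) * (x : ℂ) ^ (-(s + 1)))
            (volume.restrict (Ioi 1)) := h4.sub hI₂
        rw [integral_add h12 hI₃, integral_sub h4 hI₂, integral_const_mul]
        rfl
    _ = _ := by rw [hR₁, hR₂, hR₃]

end Summit.RiemannHypothesis.RiemannHypothesis.Theorems.ScrewSquaringLaw

end
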